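import Summits.Ventures.HodgeRepro2.T5DvrFiniteQuotients

/-!
# T5HeckeFiniteOrbitPullback — finiteness of `K'gK'/K'` pulled back along a homomorphism

Blind cell pub-hodge-repro2, seat p8, Tier-5 kernel support. The standing hypothesis `hfin` («every
`KgK/K` is finite») of the Hecke files T5-52 … T5-114 was discharged in gen 11 for `K = GL_n(R) ⊂ GL_n(F)`
(T5CongruenceOrbitFinite / T5DvrFiniteQuotients). The unitary groups of the record at the INERT places are
SUBGROUPS `U ≤ GL_n(E_v)` with hyperspecial `K_v = U ∩ GL_n(𝒪_{E_v})` (the stabiliser of a self-dual lattice in a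
basis where it is `𝒪^n`); this file transports the finiteness to them:

* `cosetMapHom f hf : G' ⧸ K' → G ⧸ K` for a homomorphism `f : G' →* G` with `f⁻¹(K) = K'`
  (`hf : ∀ x, f x ∈ K ↔ x ∈ K'`) is INJECTIVE and carries the `K'`-orbit of `xK'` into the `K`-orbit of `f(x)K`;
  hence `Finite (K'xK'/K')` whenever `Finite (K f(x) K / K)` (`finite_orbit_of_hom`) — T5GelfandTransport's
  `cosetMap` for an isomorphism generalised to any homomorphism (no injectivity of `f` is needed);
* for a subgroup `H ≤ G` with `K' := K.subgroupOf H` (`= K ∩ H`) this is `finite_orbit_subgroupOf`;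
* for `G = GL ι F`, `K = GL_n(R)` with `R` a PID with finite quotients, or a DVR with finite residue field,
  every `K'xK'/K'` is finite for every subgroup `H ≤ GL ι F` and every `f : G' →* GL ι F` with
  `f⁻¹(GL_n(R)) = K'` — `finite_orbit_subgroupOf_GL`, `finite_orbit_of_hom_GL`, and the instance
  `instFiniteOrbitSubgroupOf` (needed by the STATEMENTS that use T5HeckeDoubleCoset's `doubleCosetOp`).

Nothing is asserted about a specific unitary group: the identification of the record's `K_v` with
`U ∩ GL_n(𝒪_v)` is a reading (T5UnitaryGroupForm consumes this file with `H := formUnitaryGroup J`).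
-/

namespace Summit.Ventures.HodgeRepro2.T5HeckeFiniteOrbitPullback

open Summit.Ventures.HodgeRepro2

section General

variable {G G' : Type*} [Group G] [Group G'] {K : Subgroup G} {K' : Subgroup G'}

/-- The map `G' ⧸ K' → G ⧸ K`, `xK' ↦ f(x)K`, induced by a homomorphism `f` with `f⁻¹(K) = K'`. -/
def cosetMapHom (f : G' →* G) (hf : ∀ x, f x ∈ K ↔ x ∈ K') : G' ⧸ K' → G ⧸ K :=
  Quotient.map' f fun a b hab => by
    rw [QuotientGroup.leftRel_apply] at hab ⊢
    rw [← map_inv, ← map_mul]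
    exact (hf _).2 hab

/-- `cosetMapHom` on a coset representative. -/
@[simp] theorem cosetMapHom_mk (f : G' →* G) (hf : ∀ x, f x ∈ K ↔ x ∈ K') (x : G') :
    cosetMapHom f hf (x : G' ⧸ K') = (f x : G ⧸ K) := rfl

/-- `cosetMapHom` is injective: `f(x)K = f(y)K` forces `f(x⁻¹ y) ∈ K`, i.e. `x⁻¹ y ∈ K'`. -/
theorem cosetMapHom_injective (f : G' →* G) (hf : ∀ x, f x ∈ K ↔ x ∈ K') :
    Function.Injective (cosetMapHom f hf) := by
  intro a b h
  induction a using QuotientGroup.induction_on with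
  | H a =>
  induction b using QuotientGroup.induction_on with
  | H b =>
  rw [cosetMapHom_mk, cosetMapHom_mk, QuotientGroup.eq] at h
  rw [QuotientGroup.eq]
  rw [← map_inv, ← map_mul] at h
  exact (hf _).1 h

/-- `cosetMapHom` is `K'`-equivariant: `κ • xK' ↦ f(κ) • f(x)K`. -/
theorem cosetMapHom_smul (f : G' →* G) (hf : ∀ x, f x ∈ K ↔ x ∈ K') (κ : K') (y : G' ⧸ K') :
    cosetMapHom f hf (κ • y) = (⟨f κ, (hf κ).2 κ.2⟩ : K) • cosetMapHom f hf y := by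
  induction y using QuotientGroup.induction_on with
  | H y =>
  change cosetMapHom f hf ((κ : G') * y : G') = (⟨f κ, (hf κ).2 κ.2⟩ : K) • ((f y : G) : G ⧸ K)
  rw [cosetMapHom_mk, map_mul]
  rfl

/-- The `K'`-orbit of `xK'` is carried into the `K`-orbit of `f(x)K`. -/
theorem cosetMapHom_mem_orbit (f : G' →* G) (hf : ∀ x, f x ∈ K ↔ x ∈ K') (x : G') {y : G' ⧸ K'}
    (hy : y ∈ MulAction.orbit K' (x : G' ⧸ K')) :
    cosetMapHom f hf y ∈ MulAction.orbit K (f x : G ⧸ K) := by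
  rw [MulAction.mem_orbit_iff] at hy ⊢
  obtain ⟨κ, rfl⟩ := hy
  exact ⟨⟨f κ, (hf κ).2 κ.2⟩, by rw [cosetMapHom_smul, cosetMapHom_mk]⟩

/-- FINITENESS PULLS BACK: if every `KgK/K` is finite then every `K'xK'/K'` is finite, for any
homomorphism `f : G' →* G` with `f⁻¹(K) = K'` (an injective map of the orbit into a finite set). -/
theorem finite_orbit_of_hom (f : G' →* G) (hf : ∀ x, f x ∈ K ↔ x ∈ K')
    (hfin : ∀ g : G, Finite (MulAction.orbit K (g : G ⧸ K))) (x : G') :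
    Finite (MulAction.orbit K' (x : G' ⧸ K')) := by
  haveI := hfin (f x)
  refine Finite.of_injective
    (fun y : MulAction.orbit K' (x : G' ⧸ K') =>
      (⟨cosetMapHom f hf y, cosetMapHom_mem_orbit f hf x y.2⟩ : MulAction.orbit K (f x : G ⧸ K))) ?_
  intro a b h
  exact Subtype.ext (cosetMapHom_injective f hf (congrArg Subtype.val h))

/-- The inclusion of a subgroup `H ≤ G` satisfies `f⁻¹(K) = K.subgroupOf H` (`= K ∩ H` inside `H`). -/
theorem subtype_mem_iff (H : Subgroup G) (x : H) : H.subtype x ∈ K ↔ x ∈ K.subgroupOf H :=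
  Subgroup.mem_subgroupOf.symm

/-- For a subgroup `H ≤ G` and `K' = K ∩ H`: every `K'xK'/K'` is finite when every `KgK/K` is. -/
theorem finite_orbit_subgroupOf (H : Subgroup G)
    (hfin : ∀ g : G, Finite (MulAction.orbit K (g : G ⧸ K))) (x : H) :
    Finite (MulAction.orbit (K.subgroupOf H) (x : H ⧸ K.subgroupOf H)) :=
  finite_orbit_of_hom H.subtype (subtype_mem_iff H) hfin x

end General

section GeneralLinear

variable {R : Type*} [CommRing R] [IsDomain R] {F : Type*} [Field F] [Algebra R F] [IsFractionRing R F]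
  {ι : Type*} [Fintype ι] [DecidableEq ι] {G' : Type*} [Group G'] {K' : Subgroup G'}

/-- `R` a PID with finite quotients `R ⧸ (c)` (`c ≠ 0`), `f : G' →* GL ι F` with `f⁻¹(GL_n(R)) = K'`:
every `K'xK'/K'` is finite (T5CongruenceOrbitFinite pulled back). -/
theorem finite_orbit_of_hom_GL_of_finite_quotients [IsPrincipalIdealRing R]
    (hQ : ∀ c : R, c ≠ 0 → Finite (R ⧸ Ideal.span {c})) (f : G' →* GL ι F)
    (hf : ∀ x, f x ∈ (Matrix.GeneralLinearGroup.map (algebraMap R F)).range ↔ x ∈ K') (x : G') :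
    Finite (MulAction.orbit K' (x : G' ⧸ K')) :=
  finite_orbit_of_hom f hf (T5CongruenceOrbitFinite.finite_orbit_of_finite_quotients hQ) x

/-- `R` a DVR with finite residue field, `f : G' →* GL ι F` with `f⁻¹(GL_n(R)) = K'`: every `K'xK'/K'`
is finite — no remaining hypothesis (T5DvrFiniteQuotients supplies the finite quotients). -/
theorem finite_orbit_of_hom_GL [IsDiscreteValuationRing R] [Finite (IsLocalRing.ResidueField R)]
    (f : G' →* GL ι F)
    (hf : ∀ x, f x ∈ (Matrix.GeneralLinearGroup.map (algebraMap R F)).range ↔ x ∈ K') (x : G') :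
    Finite (MulAction.orbit K' (x : G' ⧸ K')) :=
  finite_orbit_of_hom_GL_of_finite_quotients
    (fun c hc => T5DvrFiniteQuotients.finite_quotient_span_singleton c hc) f hf x

/-- `R` a DVR with finite residue field, `H ≤ GL ι F` any subgroup, `K' = H ∩ GL_n(R)`: every `K'xK'/K'`
is finite — the hypothesis `hfin` of the Hecke files for the unitary groups `U ≤ GL_n(E_v)` at the inert
places with their hyperspecial `K_v = U ∩ GL_n(𝒪_v)`. -/
theorem finite_orbit_subgroupOf_GL [IsDiscreteValuationRing R] [Finite (IsLocalRing.ResidueField R)]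
    (H : Subgroup (GL ι F)) (x : H) :
    Finite (MulAction.orbit ((Matrix.GeneralLinearGroup.map (algebraMap R F)).range.subgroupOf H)
      (x : H ⧸ (Matrix.GeneralLinearGroup.map (algebraMap R F)).range.subgroupOf H)) :=
  finite_orbit_of_hom_GL H.subtype (subtype_mem_iff H) x

/-- The same as an instance (T5HeckeDoubleCoset's `doubleCosetOp` takes the finiteness as an instance
argument in the STATEMENTS). -/
instance instFiniteOrbitSubgroupOf [IsDiscreteValuationRing R] [Finite (IsLocalRing.ResidueField R)]
    (H : Subgroup (GL ι F)) (x : H) :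
    Finite (MulAction.orbit ((Matrix.GeneralLinearGroup.map (algebraMap R F)).range.subgroupOf H)
      (x : H ⧸ (Matrix.GeneralLinearGroup.map (algebraMap R F)).range.subgroupOf H)) :=
  finite_orbit_subgroupOf_GL H x

end GeneralLinear

end Summit.Ventures.HodgeRepro2.T5HeckeFiniteOrbitPullback
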